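import Summits.QuantumFields.YangMills.Theorems.BalabanUVNodesN15KingModelContourPhaseRate
import Literature.MathematicalPhysics.QuantumFieldTheory.Balaban1983to89.B10Eq29CplxLine
import Literature.MathematicalPhysics.QuantumFieldTheory.Balaban1983to89.B15Ineq146Proof
import HarnessLib

/-!
# BalabanUVNodes ∕ N15 — THE KING-MODEL RUNG, CURVED EDITION (PART Ο): THE SHAPE OF KING's (3.72) FOR A CONSTANT **NON-ABELIAN** BACKGROUND —
# path-ordered exponentials `Π_{b∈Γ} exp(±η·B_{μ(b)})` of skew-adjoint, NON-COMMUTING `B_μ` in a unital C*-algebra along King's nested contours (2.12):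
# the two-spacing difference of the dressings is `≤ (d+1)·e·s·‖B‖_∞·L^{−k}` — the abelian (3.72) VERBATIM, by NESTING (parts Κ-a ∕ Κ-b), not by path-independence
# (Track A, DAG node N15 = NE2; FAN-OUT v1.1 §N15 s3 «KING-MODEL RUNG … the one-line statement of what the curved case adds»)

HONEST FRAMING.  Count-neutral (cell `pub-ymgap`, seat `pub-ymgap-dag-n15-e` g24; `--supports stmt-QuantumFields-27366 --as helper` = K3⁸
`SpineGivenEndpointR13SepCoPHV`).  A MODEL REMARK on «what the curved case adds» at the dressing: [King1986] (C. King, CMP **102** (1986) 649–677) prints (3.72)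
p. 665 for the U(1) phase `U(B(Γ)) = exp[e(L^kε)^{2−d∕2}qB(Γ)]` of a CONSTANT field `B` (p. 661); parts Κ-a∕Κ-b proved it BY NAME and isolated the mechanism
(`Contour.norm_headed_prod_nested_sub_le`: along NESTED contours, ordered products of bond transporters of norm `≤ 1` differ by the tail only — NO commutativity).
THIS FILE DISCHARGES the two hypotheses of that mechanism for the natural non-abelian transporters — `U_b = exp(±t·B_μ)` with `B_μ` SKEW-ADJOINT elements of a
unital C*-algebra `𝔸` (e.g. `𝔲(N) ⊂ M_N(ℂ)`), NOT assumed to commute (so the constant connection has curvature `[B_μ, B_ν] ≠ 0` in general): `‖U_b‖ = 1` (unitarity,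
the tree's `B10Eq29CplxLine.exp_real_smul_mem_unitary` + Mathlib `CStarRing.norm_of_mem_unitary`) and `‖U_b − 1‖ ≤ t‖B_μ‖` (the tree's
`B15Ineq146Proof.norm_exp_sub_one_le_of_skew`, `‖exp X − 1‖ ≤ ‖X‖`).  NOT
Bałaban's `G(U)` of [B9] (the non-abelian NE2 dressing of the rider of ruling №252 is an OPERATOR dressing, road (c), dag-n15-c's pen); NOT a node discharge; nothing
continuum ∕ ℝ⁴ ∕ OS ∕ mass-gap ∕ Clay.  0 `sorry`; standard axioms.

WHAT THIS FILE PROVES (namespace `…N15KingModelRung.Curved`; `𝔸` any nontrivial unital C*-algebra (Mathlib `CStarAlgebra`); King's tori and contours of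
parts Κ-a∕Κ-b).
* §1 C*-LETTERS: `norm_exp_smul_skewAdjoint` (`‖exp(t·b)‖ = 1`, from the tree's `B10Eq29CplxLine.exp_real_smul_mem_unitary`), `exp_smul_pow` (`exp(t·b)^m =
  exp((m·t)·b)` — the coarse bond of `m = L^n` fine bonds); the chord bound `‖exp X − 1‖ ≤ ‖X‖` for skew-adjoint `X` IS the tree's
  `B15Ineq146Proof.norm_exp_sub_one_le_of_skew` ([Balaban1985Averaging] (24)), imported and used BY NAME (not restated; `B10Eq28RegularTube.norm_exp_real_smul_sub_one_le`
  is the same in the `t • K` spelling).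
* §2 THE NON-ABELIAN BOND TRANSPORTERS `naTransporter t B s = exp((±t)·B_{μ(s)})` along a contour step and the PATH-ORDERED DRESSING
  `naDressing L K M t B g x = g(B(x))·Π_{s ∈ Γ^{(K)}_{y,x}} naTransporter t B s` (head transporter `g(y)` of norm `≤ 1` on the unit lattice — King's `Γ_{x₀,y}` part, any
  choice); `norm_naTransporter` (= 1), `norm_naTransporter_sub_one_le` (`≤ |t|·‖B‖_∞`), `naTransporter_pow` (`U_s(t)^{L^n} = U_s(L^n·t)`: the coarse transporter).
* §3 ★★★ **`norm_naDressing_nested_sub_le`**: for skew-adjoint `B_μ` with `‖B_μ‖ ≤ β`, heads of norm `≤ 1`, every `K, n, M`, `t`, every fine point `x′` (`x = kingSlicePt x′`):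
  `‖naDressing (K+n) t − naDressing K (L^n·t)‖ ≤ (d+1)·L^n·|t|·β`; ★★★ **`norm_naDressing_nested_sub_le_eta`**: at `t = e·s·η′` (`η′ = L^{−(K+n)}`, so the coarse bonds
  carry `e·s·η`, `η = L^{−K}`) the bound is `(d+1)·e·s·β·L^{−K}` — THE ABELIAN (3.72) SHAPE VERBATIM for a constant non-abelian background (the U(1) case itself IS
  part Κ-b's `kingDressing` ∕ `kingDressing_eq_prod`, not restated).

HONEST SCOPE.  (i) Constant background (`B_μ` independent of the site), as in King's (3.46); the curvature of a constant non-abelian connection is the commutator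
`[B_μ, B_ν]`, which this file neither uses nor bounds — the point is that the rate needs no commutativity.  (ii) `𝔸` abstract (any unital C*-algebra with the
listed structure; matrices `M_N(ℂ)` with the operator norm qualify); no lattice gauge field `U(b)` varying with `b`, no plaquette action, no Bałaban averaging.
(iii) A statement about King-type contour dressings, not about [B9]'s `G(U)`; rider №252 ∕ FLAG №13 untouched; N15's booking unchanged; counts unmoved.
Locators: [King1986] (2.12) p.653, (3.46) p.661, (3.72) p.665.
-/

noncomputable section

namespace Summit.QuantumFields.YangMills.BalabanUVNodes.N15KingModelRung.Curved

open scoped BigOperators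
open NormedSpace
open Literature.MathematicalPhysics.QuantumFieldTheory.Balaban1983to89.B5Prop11Plancherel (Tor fine)
open Literature.MathematicalPhysics.QuantumFieldTheory.King1986.Torus (blockOf)
open Summit.QuantumFields.YangMills.BalabanUVNodes.N15KingModelRung.Contour

open Literature.MathematicalPhysics.QuantumFieldTheory.Balaban1983to89.B15Ineq146Proof (norm_exp_sub_one_le_of_skew)
open Literature.MathematicalPhysics.QuantumFieldTheory.Balaban1983to89.B10Eq29CplxLine (exp_real_smul_mem_unitary)

variable {𝔸 : Type*} [CStarAlgebra 𝔸] [Nontrivial 𝔸]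

/-! ## §1 C*-letters: exponentials of skew-adjoint elements are unitaries of norm one, within `‖b‖` of the identity -/

section CStarLetters

/-- `exp(t·b)` is unitary (the tree's `B10Eq29CplxLine.exp_real_smul_mem_unitary`), hence of norm EXACTLY `1` in a nontrivial C*-algebra. [folklore] -/
theorem norm_exp_smul_skewAdjoint {b : 𝔸} (hb : b ∈ skewAdjoint 𝔸) (t : ℝ) : ‖exp (t • b)‖ = 1 :=
  CStarRing.norm_of_mem_unitary (exp_real_smul_mem_unitary hb t)

omit [Nontrivial 𝔸] in
/-- `exp(t·b)^m = exp((m·t)·b)`: `m` fine bonds of one direction compose to the coarse bond (`b` commutes with itself). [folklore] -/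
theorem exp_smul_pow (b : 𝔸) (t : ℝ) (m : ℕ) : exp (t • b) ^ m = exp (((m : ℝ) * t) • b) := by
  letI : NormedAlgebra ℚ 𝔸 := NormedAlgebra.restrictScalars ℚ ℂ 𝔸
  rw [← exp_nsmul, ← Nat.cast_smul_eq_nsmul ℝ, smul_smul]

end CStarLetters

/-! ## §2 The non-abelian bond transporters along King's contours and the path-ordered dressing -/

section Transporters

variable {D : ℕ}

/-- the sign `±1` of a contour step's orientation. [cite: King1986, (2.12) p.653] -/
def stepSign (s : ContourStep D) : ℝ := if s.2 then 1 else -1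

/-- `|±1| = 1`. [folklore] -/
theorem abs_stepSign (s : ContourStep D) : |stepSign s| = 1 := by
  unfold stepSign; split_ifs <;> simp

/-- **THE NON-ABELIAN BOND TRANSPORTER** of a step at phase-per-bond `t` (`t = e·s·η` on the `η`-lattice): `U_s = exp((±t)·B_{μ(s)})` for a CONSTANT background
`B : Fin D → 𝔸` (skew-adjoint, non-commuting allowed). [cite: King1986, (2.11)–(2.12) p.653, (3.46) p.661] -/
def naTransporter (t : ℝ) (B : Fin D → 𝔸) (s : ContourStep D) : 𝔸 := exp ((stepSign s * t) • B s.1)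

/-- unitarity: `‖U_s‖ = 1`. [folklore] -/
theorem norm_naTransporter {B : Fin D → 𝔸} (hB : ∀ μ, B μ ∈ skewAdjoint 𝔸) (t : ℝ) (s : ContourStep D) : ‖naTransporter t B s‖ = 1 :=
  norm_exp_smul_skewAdjoint (hB s.1) _

omit [Nontrivial 𝔸] in
/-- `‖U_s − 1‖ ≤ |t|·‖B‖_∞`. [folklore] -/
theorem norm_naTransporter_sub_one_le {B : Fin D → 𝔸} (hB : ∀ μ, B μ ∈ skewAdjoint 𝔸) {β : ℝ} (hβ : ∀ μ, ‖B μ‖ ≤ β) (t : ℝ) (s : ContourStep D) :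
    ‖naTransporter t B s - 1‖ ≤ |t| * β := by
  unfold naTransporter
  -- `‖exp X − 1‖ ≤ ‖X‖` for the skew-adjoint `X = (±t)·B_μ` (the tree's `B15Ineq146Proof.norm_exp_sub_one_le_of_skew`, [12] (24)), `‖X‖ = |t|‖B_μ‖`
  refine (norm_exp_sub_one_le_of_skew (skewAdjoint.smul_mem _ (hB s.1))).trans ?_
  rw [norm_smul, Real.norm_eq_abs, abs_mul, abs_stepSign, one_mul]
  exact mul_le_mul_of_nonneg_left (hβ s.1) (abs_nonneg t)

omit [Nontrivial 𝔸] in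
/-- **the coarse transporter is the `L^n`-th power of the fine one**: `U_s(t)^{m} = U_s(m·t)` (an `η`-bond = `m = L^n` consecutive `η′`-bonds of the same direction).
[cite: King1986, (2.12) p.653, p.664 («x′ ∈ B^n(x)»)] -/
theorem naTransporter_pow (t : ℝ) (B : Fin D → 𝔸) (m : ℕ) (s : ContourStep D) : naTransporter t B s ^ m = naTransporter ((m : ℝ) * t) B s := by
  unfold naTransporter
  rw [exp_smul_pow]
  congr 1
  congr 1
  ring

variable {d : ℕ} (L : ℕ) [NeZero L]

/-- **THE PATH-ORDERED DRESSING** along King's contour: a head transporter `g(y)` (the unit-lattice part `Γ_{x₀,y}`, any choice) times the ordered product of the bond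
transporters along the block staircase `Γ^{(K)}_{y,x}` (2.12), phase-per-bond `t`. [cite: King1986, (3.46) p.661, (2.11)–(2.12) p.653] -/
def naDressing (K : ℕ) (M : Fin (d + 1) → ℕ) [∀ μ, NeZero (M μ)] (t : ℝ) (B : Fin (d + 1) → 𝔸) (g : Tor M → 𝔸) (x : Tor (fine (L ^ K) M)) : 𝔸 :=
  g (blockOf (L ^ K) M x) * ((kingBlockContour L K M x).map (naTransporter t B)).prod

end Transporters

/-! ## §3 The shape of (3.72) for the constant non-abelian background -/

section NonAbelian372

variable {d : ℕ} (L : ℕ) [NeZero L]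

/-- ★★★ **THE TWO-SPACING DIFFERENCE OF THE NON-ABELIAN DRESSINGS ALONG KING's NESTED CONTOURS**: for skew-adjoint `B_μ` (NOT assumed to commute) with `‖B_μ‖ ≤ β`,
unit-lattice heads `g(y)` of norm `≤ 1`, phase-per-fine-bond `t`, every `K, n, M` and every fine point `x′` (`x = kingSlicePt x′`; the coarse dressing runs at
phase-per-bond `L^n·t`): `‖𝒰^{(K+n)}(x′) − 𝒰^{(K)}(x)‖ ≤ (d+1)·L^n·|t|·β` — parts Κ-a∕Κ-b's nesting mechanism with its two hypotheses DISCHARGED by §1.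
[cite: King1986, (3.72) p.665, (2.12) p.653, p.664 (pairing)] -/
theorem norm_naDressing_nested_sub_le (K n : ℕ) (M : Fin (d + 1) → ℕ) [∀ μ, NeZero (M μ)] {B : Fin (d + 1) → 𝔸} (hB : ∀ μ, B μ ∈ skewAdjoint 𝔸)
    {β : ℝ} (hβ : ∀ μ, ‖B μ‖ ≤ β) (g : Tor M → 𝔸) (hg : ∀ y, ‖g y‖ ≤ 1) (t : ℝ) (x' : Tor (fine (L ^ (K + n)) M)) :
    ‖naDressing L (K + n) M t B g x' - naDressing L K M (((L ^ n : ℕ) : ℝ) * t) B g (kingSlicePt L K n M x')‖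
      ≤ ((d : ℝ) + 1) * (L : ℝ) ^ n * (|t| * β) := by
  have hβ0 : 0 ≤ β := (norm_nonneg _).trans (hβ 0)
  have hθ0 : 0 ≤ |t| * β := mul_nonneg (abs_nonneg t) hβ0
  have hpow : (fun s => naTransporter t B s ^ L ^ n) = naTransporter (((L ^ n : ℕ) : ℝ) * t) B := by
    funext s; rw [naTransporter_pow]
  unfold naDressing
  rw [← hpow]
  exact norm_headedProd_kingBlockContour_nested_sub_le L K n M (naTransporter t B) (fun s => (norm_naTransporter hB t s).le) hθ0
    (norm_naTransporter_sub_one_le hB hβ t) g hg x'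

/-- ★★★ **… AT KING's PHASE-PER-BOND `t = e·s·η′`** (`η′ = L^{−(K+n)}`; then the coarse bonds carry `L^n·t = e·s·η`, `η = L^{−K}`, exactly as in (3.46) on `T_η`):
`‖𝒰^{(K+n)}(x′) − 𝒰^{(K)}(x)‖ ≤ (d+1)·e·s·β·L^{−K}` for `e, s ≥ 0` — THE ABELIAN (3.72) SHAPE VERBATIM (part Κ-b `norm_kingDressing_sub_le`) for a constant NON-ABELIAN
background; with (3.2)₁ `β ≤ p(L^{k−1}ε)(μ₀L^{k−1}ε)^{−1}` and part Κ-b's `pFn_div_le` this is `≤ (d+1)L(1+log L)^p·e·(L^kε)^{2−d∕2}·L^{−k}·p(L^kε)∕(μ₀L^kε)`.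
[cite: King1986, (3.72) p.665, (3.46) p.661] -/
theorem norm_naDressing_nested_sub_le_eta (K n : ℕ) (M : Fin (d + 1) → ℕ) [∀ μ, NeZero (M μ)] {B : Fin (d + 1) → 𝔸} (hB : ∀ μ, B μ ∈ skewAdjoint 𝔸)
    {β : ℝ} (hβ : ∀ μ, ‖B μ‖ ≤ β) (g : Tor M → 𝔸) (hg : ∀ y, ‖g y‖ ≤ 1) {e s : ℝ} (he : 0 ≤ e) (hs : 0 ≤ s) (x' : Tor (fine (L ^ (K + n)) M)) :
    ‖naDressing L (K + n) M (e * s * ((L : ℝ) ^ (K + n))⁻¹) B g x' - naDressing L K M (e * s * ((L : ℝ) ^ K)⁻¹) B g (kingSlicePt L K n M x')‖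
      ≤ ((d : ℝ) + 1) * e * s * β * ((L : ℝ) ^ K)⁻¹ := by
  have hL0 : (0 : ℝ) < L := by exact_mod_cast Nat.pos_of_ne_zero (NeZero.ne L)
  have hcoarse : ((L ^ n : ℕ) : ℝ) * (e * s * ((L : ℝ) ^ (K + n))⁻¹) = e * s * ((L : ℝ) ^ K)⁻¹ := by
    push_cast; rw [pow_add]; field_simp
  have h := norm_naDressing_nested_sub_le L K n M hB hβ g hg (e * s * ((L : ℝ) ^ (K + n))⁻¹) x'
  rw [hcoarse] at h
  refine h.trans (le_of_eq ?_)
  rw [abs_of_nonneg (by positivity : 0 ≤ e * s * ((L : ℝ) ^ (K + n))⁻¹), pow_add]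
  field_simp

end NonAbelian372

end Summit.QuantumFields.YangMills.BalabanUVNodes.N15KingModelRung.Curved

end
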